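import Summits.QuantumFields.BalabanUV.Beta.GAN24.WrecAtSlotRows
import Summits.QuantumFields.BalabanUV.Beta.GAN24.W3SourceRows

/-!
# `BalabanUV.Beta.GAN24.T2RecSourceRows` — binder row G-an2-4 ∕ (CONV-C), **CT-W ROW (F4): THE SOURCE ROWS OF THE DRESSED AFFINE TOWER** — the `T̃`-free source
# `b̃_j = (cE₂·Lc^{2(d+1)}) • mmRead Lc (K3OfK G̃_j Lc S̃′_j M̃_j (W2SymOfK G̃_j Lc S̃′_j M̃_j 0 M̃₂_j)) + cB • vh₂S` of `T2RecOfUnitSplit.unitS₂_T2RecOf_eq_transport_add_sum` at the comb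
# data (`G_j = coDressKBmAt ρ Lc (KInvStep Lc j)`, `S = SpureRecAt ρ`, `M = M1At ρ cΛ`) is `j`-UNIFORMLY `LocStencil₂` (road W3's F4a, `LocStencil₂` half) and CAUCHY AT A
# GEOMETRIC RATE (F4b's source socket), as FUNCTIONS of the dressed K rows and «S′Shape» ∧ «S′Drift»; at `d = 3` from the comb family's (hS, hSall) ALONE
NOT IN PRINT; OUR BOOKKEEPING (road-P2 chair of row G-an2-4, unit `b2b-balaban-gan24-p2` gen 35, crux team (2); «CT-W SCOPING» [GAN24P2-G35-INTENT1]; memo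
`HOME/b2b-balaban-gan24-p2/gen35/CT-W-SCOPE-v0.md` §2 (F4)).  HONEST FRAMING (cell contract, verbatim): «discharging `BetaPertH` makes Bałaban's UV stability UNCONDITIONAL —
a real constructive-QFT result; it is NOT the continuum limit and NOT the Clay problem.»  HONEST DEPENDENCY (verbatim): «continuum YM on T⁴ ⇐ BetaPertH ∧ nine spine
estimates (0/9 proved); BetaPertH ⇐ (D1) ∧ (D4) ∧ CAP+tail; G-an2-4 gates asym, D1 and NE2/3/4.»  [folklore] composition BY NAME (0 `def`, 0 cited facts, 0 `def … : Prop`,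
0 sorry): the dressed twin of leaf-08's `W3SourceRows.source_shape_of_shapes` ∕ `source_cauchy_of_shapes` over the SAME engine lemmas, generic in the kernel family —
leaf-19's `T2SlotOfHW.locStencil₂_mmRead_K3OfK_family`, leaf-08's `ValueReadoutLipschitz.mmRead_K3OfK_cauchy`, an1's `vertexFamily₂_W2SymOfK`, leaf-07's
`SecondOrderLipschitzW2.vertexFamily₂_W2SymOfK_sub` (`WrecAtSlotOfShapes.unitM_M1At_eq`: the multiplier slot is `j`-free).  §1 (generic `d`, in-block root; dressed K rows,
«S′Shape»∕«S′Drift», mixed-table letters, border shape as HYPOTHESES): `vertexFamily₂_zeroCarrier_of_rows`, `vertexFamily₂_zeroCarrier_cauchy_of_rows`,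
**`source_shape_of_rows`**, **`source_cauchy_of_rows`**; §2 (`d = 3`, `2 ≤ Lc`, `mixFFAt (toSite r) Lc`) **`source_rows_three_of_srecAt_rows`** — both rows from the comb
family's (hS, hSall) and a `LocStencil₂` shape of `vh₂S` ALONE (dressed K by asym1's `exists_coDressedBm_unit_rows` ∘ road P1's `convCKWall_holds`; S′ rows by
`WrecAtSlotRows.exists_spureRecAt_rows_three_of_srecAt_rows`).  NOT HERE: the `mom` ∕ `Zfree` halves of road W3's (F4)∕(F2) and the transport rows (F3) — OPEN (CT-W).
Discharges NOTHING of «T2Shape» ∕ «T2Drift» ∕ (hW, hWall); NEVER «G-an2-4 closed» as (CONV-C); NOT D1, NOT `BetaPertH`, NOT continuum, NOT Clay; not in print.  2026-08-21.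
-/

noncomputable section

open Finset
open scoped BigOperators
open Literature.MathematicalPhysics.QuantumFieldTheory
open Literature.MathematicalPhysics.QuantumFieldTheory.Balaban1983to89
open Literature.MathematicalPhysics.QuantumFieldTheory.Balaban1983to89.Beta
open B12Sec2to5 (l1 l1_nonneg)
open ExpKernelCalculus (MKer Decays BiLoc VertexFamily VertexFamily₂)
open OneStepResolventKernel (Fib LocStencil decays_mono biLoc_mono)
open OneStepKernelFamily (KInvStep)
open AffineAveraging (box toSite)
open AveragingHessianKernels (ell)
open AveragingHessianKernelsRooted (hessFFAt)
open AveragingMixedJetTables (mixFFAt mixFFAt_inl_inr mixFFAt_inr)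
open BalabanStepJets (locStencil_mono vertexFamily₂_mono)
open BalabanStepJetsSucc (mmRead)
open BalabanCompositeJets (LocStencil₂)
open SecondOrderResponse (W2SymOfK W2SymOfK_swap LocStencilFM vertexFamily₂_W2SymOfK CW2)
open BalabanStepW2 (M2Of K3OfK locStencil₂_smul' locStencil₂_add' biLoc_le_mono)
open Summit.QuantumFields.BalabanUV.Beta.HessKerDressedUnits (unitK unitS unitW)
open Summit.QuantumFields.BalabanUV.Beta.SecondOrderUnits (unitM unitS₂ unitM₂)
open Summit.QuantumFields.BalabanUV.Beta.AxialDressingRooted (coDressKBmAt)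
open Summit.QuantumFields.BalabanUV.Beta.SpineRooted (SpureRecAt M1At)
open Summit.QuantumFields.BalabanUV.Beta.WardLocusRecursive (SrecAt)
open Summit.QuantumFields.BalabanUV.Beta.HessKerCoDressedBmWall (exists_coDressedBm_unit_rows)
open Summit.QuantumFields.BalabanUV.Beta.MixedJetTablesPlug (hmix_an1)
open Summit.QuantumFields.BalabanUV.Beta.GAN24.CombesThomas (sfStep smStep sfStep_ne_zero smStep_ne_zero)
open Summit.QuantumFields.BalabanUV.Beta.GAN24.KSlotAssembly (convCKWall_holds)
open Summit.QuantumFields.BalabanUV.Beta.GAN24.StencilSlotOfShapes (locStencil_mono')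
open Summit.QuantumFields.BalabanUV.Beta.GAN24.WSlotOfShapes (unitM₂_M2Of_eq locStencilFM_unitM₂_M2Of)
open Summit.QuantumFields.BalabanUV.Beta.GAN24.WSlotCauchyOfShapes (locStencil₂_le_mono vertexFamily_zero locStencilFM_zero mul_pow_le_mul_pow)
open Summit.QuantumFields.BalabanUV.Beta.GAN24.SecondOrderLipschitzW2 (LW2 LW2_mul vertexFamily₂_W2SymOfK_sub)
open Summit.QuantumFields.BalabanUV.Beta.GAN24.T2SlotOfHW (locStencil₂_mmRead_K3OfK_family)
open Summit.QuantumFields.BalabanUV.Beta.GAN24.ValueReadoutLipschitz (lK3 lK3_nonneg mmRead_K3OfK_cauchy)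
open Summit.QuantumFields.BalabanUV.Beta.GAN24.W3SourceRows (locStencil₂_zero_table smul_add_sub_smul_add)
open Summit.QuantumFields.BalabanUV.Beta.GAN24.WrecAtSlotOfShapes (unitM_M1At_eq vertexFamily_smul_hessFFAt)
open Summit.QuantumFields.BalabanUV.Beta.GAN24.WrecAtSlotRows (exists_spureRecAt_rows_three_of_srecAt_rows)

namespace Summit.QuantumFields.BalabanUV.Beta.GAN24.T2RecSourceRows

variable {d : ℕ} {Lc : ℕ} [NeZero Lc]

/-! ## §1 Generic `d`: the zero-`T₂` dressed carrier, then the source rows -/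
section Generic
variable {r : Fin (d + 1) → ℕ} (cE cVH cΛ : ℝ)
  {mixFF : Fin (d + 1) → (Fin (d + 1) → ℤ) → Fin (d + 1) → (Fin (d + 1) → ℤ) → MKer (d + 1) (Fib d)}

/-- [folklore] **THE ZERO-`T₂` DRESSED CARRIER IS `j`-UNIFORMLY A VERTEX FAMILY**: from the dressed K uniform row, «S′Shape» and the mixed-table letters,
`∃ Cw δW, 0 < δW ∧ ∀ j, VertexFamily₂ (W2SymOfK G̃_j Lc S̃′_j M̃_j 0 M̃₂_j) Lc Cw δW` (an1's `vertexFamily₂_W2SymOfK` at the common rate; the multiplier slot by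
`unitM_M1At_eq`, the mixed slot by `unitM₂_M2Of_eq`). -/
theorem vertexFamily₂_zeroCarrier_of_rows (hLc : 1 ≤ Lc) (hr : r ∈ box (d + 1) Lc) {C δ : ℝ}
    (hG : ∀ j, Decays (unitK (sfStep Lc j) (smStep d Lc j) (coDressKBmAt (toSite r) Lc (KInvStep (d := d) Lc j))) C δ) (hδ : 0 < δ)
    {Cs δs : ℝ} (hS : ∀ j, LocStencil (unitS (sfStep Lc j) (smStep d Lc j) (SpureRecAt d Lc (toSite r) cE cVH cΛ j)) Cs δs) (hδs : 0 < δs)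
    {CM₂ δ₄ : ℝ} (hmix : LocStencilFM Lc mixFF CM₂ δ₄) (hδ₄ : 0 < δ₄)
    (hfm : ∀ κ u ρ w x z (α μ' : Fin (d + 1)), mixFF κ u ρ w x z (Sum.inl α) (Sum.inr μ') = 0)
    (hm : ∀ κ u ρ w x z (μ' : Fin (d + 1)) (b : Fib d), mixFF κ u ρ w x z (Sum.inr μ') b = 0) :
    ∃ Cw δW : ℝ, 0 < δW ∧ ∀ j, VertexFamily₂ (W2SymOfK (unitK (sfStep Lc j) (smStep d Lc j) (coDressKBmAt (toSite r) Lc (KInvStep (d := d) Lc j))) Lc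
      (unitS (sfStep Lc j) (smStep d Lc j) (SpureRecAt d Lc (toSite r) cE cVH cΛ j)) (unitM (sfStep Lc j) (smStep d Lc j) (M1At d Lc (toSite r) cΛ j)) 0
      (unitM₂ (sfStep Lc j) (smStep d Lc j) (M2Of d Lc mixFF j))) Lc Cw δW := by
  have hC : 0 ≤ C := (hG 0).nonneg (Sum.inl 0)
  have hCs : 0 ≤ Cs := ((hS 0) 0 0).nonneg (Sum.inl 0)
  set m : ℝ := min (min δ δs) δ₄ with hm_def
  have hm0 : 0 < m := lt_min (lt_min hδ hδs) hδ₄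
  have hm4 : m ≤ δ₄ := min_le_right _ _
  have hms : m ≤ δs := (min_le_left _ _).trans (min_le_right _ _)
  have hmK : m ≤ δ := (min_le_left _ _).trans (min_le_left _ _)
  set CM : ℝ := |cΛ| * (2 * (ell (d + 1) Lc : ℝ) ^ 2 * Real.exp (4 * ((d : ℝ) + 1) * Lc * m)) with hCM_def
  refine ⟨CW2 d C Cs CM 0 CM₂ m, m / 16, by positivity, fun j => ?_⟩
  have hK' : Decays (unitK (sfStep Lc j) (smStep d Lc j) (coDressKBmAt (toSite r) Lc (KInvStep (d := d) Lc j))) C m :=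
    decays_mono (hG j) hC le_rfl hmK
  have hS' : LocStencil (unitS (sfStep Lc j) (smStep d Lc j) (SpureRecAt d Lc (toSite r) cE cVH cΛ j)) Cs m :=
    locStencil_mono' (hS j) le_rfl hms
  have hM' : VertexFamily (unitM (sfStep Lc j) (smStep d Lc j) (M1At d Lc (toSite r) cΛ j)) Lc CM m := by
    rw [unitM_M1At_eq]
    exact vertexFamily_smul_hessFFAt hLc hr cΛ hm0.le
  have hT' : LocStencil₂ (0 : Fin (d + 1) → (Fin (d + 1) → ℤ) → Fin (d + 1) → (Fin (d + 1) → ℤ) → MKer (d + 1) (Fib d)) 0 m :=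
    locStencil₂_zero_table
  have hX' : LocStencilFM Lc (unitM₂ (sfStep Lc j) (smStep d Lc j) (M2Of d Lc mixFF j)) CM₂ m :=
    (locStencilFM_unitM₂_M2Of hmix hfm hm j).mono hm4
  exact vertexFamily₂_W2SymOfK hK' hC hm0 hS' hM' hT' hX'

/-- [folklore] **THE ZERO-`T₂` DRESSED CARRIER IS CAUCHY AT A GEOMETRIC RATE**: + the dressed K Cauchy row and «S′Drift» ⇒
`∃ cW θW δW, 0 ≤ θW ∧ θW < 1 ∧ 0 < δW ∧ ∀ k j, VertexFamily₂ (W⁰_{k+j} − W⁰_k) Lc (cW·θW^k) δW` (leaf-07's `vertexFamily₂_W2SymOfK_sub`; the `T₂`, multiplier and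
mixed slots do not move). -/
theorem vertexFamily₂_zeroCarrier_cauchy_of_rows (hLc : 1 ≤ Lc) (hr : r ∈ box (d + 1) Lc) {C δ cK θK : ℝ}
    (hG : ∀ j, Decays (unitK (sfStep Lc j) (smStep d Lc j) (coDressKBmAt (toSite r) Lc (KInvStep (d := d) Lc j))) C δ)
    (hGall : ∀ k j, Decays (unitK (sfStep Lc (k + j)) (smStep d Lc (k + j)) (coDressKBmAt (toSite r) Lc (KInvStep (d := d) Lc (k + j))) -
      unitK (sfStep Lc k) (smStep d Lc k) (coDressKBmAt (toSite r) Lc (KInvStep (d := d) Lc k))) (cK * θK ^ k) δ)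
    (hδ : 0 < δ) (hθK0 : 0 ≤ θK) (hθK1 : θK < 1)
    {Cs cS θS δs : ℝ} (hS : ∀ j, LocStencil (unitS (sfStep Lc j) (smStep d Lc j) (SpureRecAt d Lc (toSite r) cE cVH cΛ j)) Cs δs)
    (hSall : ∀ k j, LocStencil (unitS (sfStep Lc (k + j)) (smStep d Lc (k + j)) (SpureRecAt d Lc (toSite r) cE cVH cΛ (k + j)) -
      unitS (sfStep Lc k) (smStep d Lc k) (SpureRecAt d Lc (toSite r) cE cVH cΛ k)) (cS * θS ^ k) δs)
    (hδs : 0 < δs) (hθS0 : 0 ≤ θS) (hθS1 : θS < 1)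
    {CM₂ δ₄ : ℝ} (hmix : LocStencilFM Lc mixFF CM₂ δ₄) (hδ₄ : 0 < δ₄)
    (hfm : ∀ κ u ρ w x z (α μ' : Fin (d + 1)), mixFF κ u ρ w x z (Sum.inl α) (Sum.inr μ') = 0)
    (hm : ∀ κ u ρ w x z (μ' : Fin (d + 1)) (b : Fib d), mixFF κ u ρ w x z (Sum.inr μ') b = 0) :
    ∃ cW θW δW : ℝ, 0 ≤ θW ∧ θW < 1 ∧ 0 < δW ∧ ∀ k j, VertexFamily₂
      (W2SymOfK (unitK (sfStep Lc (k + j)) (smStep d Lc (k + j)) (coDressKBmAt (toSite r) Lc (KInvStep (d := d) Lc (k + j)))) Lc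
          (unitS (sfStep Lc (k + j)) (smStep d Lc (k + j)) (SpureRecAt d Lc (toSite r) cE cVH cΛ (k + j)))
          (unitM (sfStep Lc (k + j)) (smStep d Lc (k + j)) (M1At d Lc (toSite r) cΛ (k + j))) 0
          (unitM₂ (sfStep Lc (k + j)) (smStep d Lc (k + j)) (M2Of d Lc mixFF (k + j))) -
        W2SymOfK (unitK (sfStep Lc k) (smStep d Lc k) (coDressKBmAt (toSite r) Lc (KInvStep (d := d) Lc k))) Lc
          (unitS (sfStep Lc k) (smStep d Lc k) (SpureRecAt d Lc (toSite r) cE cVH cΛ k)) (unitM (sfStep Lc k) (smStep d Lc k) (M1At d Lc (toSite r) cΛ k)) 0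
          (unitM₂ (sfStep Lc k) (smStep d Lc k) (M2Of d Lc mixFF k))) Lc (cW * θW ^ k) δW := by
  have hC : 0 ≤ C := (hG 0).nonneg (Sum.inl 0)
  have hcK : 0 ≤ cK := by have h := (hGall 0 0).nonneg (Sum.inl 0); simpa using h
  have hCs : 0 ≤ Cs := ((hS 0) 0 0).nonneg (Sum.inl 0)
  have hcS : 0 ≤ cS := by have h := ((hSall 0 0) 0 0).nonneg (Sum.inl 0); simpa using h
  have hCM₂ : 0 ≤ CM₂ := hmix.nonneg
  set θW : ℝ := max θK θS with hθW_def
  have hθW0 : 0 ≤ θW := hθK0.trans (le_max_left _ _)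
  have hθW1 : θW < 1 := max_lt hθK1 hθS1
  have hKW : θK ≤ θW := le_max_left _ _
  have hSW : θS ≤ θW := le_max_right _ _
  set m : ℝ := min δ (min δs δ₄) with hm_def
  have hm0 : 0 < m := lt_min hδ (lt_min hδs hδ₄)
  have hmδ : m ≤ δ := min_le_left _ _
  have hms : m ≤ δs := (min_le_right _ _).trans (min_le_left _ _)
  have hm4 : m ≤ δ₄ := (min_le_right _ _).trans (min_le_right _ _)
  set CM : ℝ := |cΛ| * (2 * (ell (d + 1) Lc : ℝ) ^ 2 * Real.exp (4 * ((d : ℝ) + 1) * Lc * m)) with hCM_def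
  have hM : VertexFamily (fun μ w => cΛ • hessFFAt (d := d) (toSite r) Lc μ w) Lc CM m := vertexFamily_smul_hessFFAt hLc hr cΛ hm0.le
  have hmixm : LocStencilFM Lc mixFF CM₂ m := hmix.mono hm4
  refine ⟨LW2 d C Cs CM 0 CM₂ cK cS 0 0 0 m, θW, m / 16, hθW0, hθW1, by positivity, fun k j => ?_⟩
  have hK1 : Decays (unitK (sfStep Lc (k + j)) (smStep d Lc (k + j)) (coDressKBmAt (toSite r) Lc (KInvStep (d := d) Lc (k + j)))) C m :=
    decays_mono (hG (k + j)) hC le_rfl hmδ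
  have hK0 : Decays (unitK (sfStep Lc k) (smStep d Lc k) (coDressKBmAt (toSite r) Lc (KInvStep (d := d) Lc k))) C m :=
    decays_mono (hG k) hC le_rfl hmδ
  have hKK : Decays (unitK (sfStep Lc (k + j)) (smStep d Lc (k + j)) (coDressKBmAt (toSite r) Lc (KInvStep (d := d) Lc (k + j))) -
      unitK (sfStep Lc k) (smStep d Lc k) (coDressKBmAt (toSite r) Lc (KInvStep (d := d) Lc k))) (cK * θW ^ k) m :=
    decays_mono (hGall k j) (by positivity) (mul_pow_le_mul_pow hcK hθK0 hKW k) hmδ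
  have hS1 : LocStencil (unitS (sfStep Lc (k + j)) (smStep d Lc (k + j)) (SpureRecAt d Lc (toSite r) cE cVH cΛ (k + j))) Cs m :=
    locStencil_mono' (hS (k + j)) le_rfl hms
  have hS0 : LocStencil (unitS (sfStep Lc k) (smStep d Lc k) (SpureRecAt d Lc (toSite r) cE cVH cΛ k)) Cs m :=
    locStencil_mono' (hS k) le_rfl hms
  have hSS : LocStencil (unitS (sfStep Lc (k + j)) (smStep d Lc (k + j)) (SpureRecAt d Lc (toSite r) cE cVH cΛ (k + j)) -
      unitS (sfStep Lc k) (smStep d Lc k) (SpureRecAt d Lc (toSite r) cE cVH cΛ k)) (cS * θW ^ k) m :=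
    locStencil_mono' (hSall k j) (mul_pow_le_mul_pow hcS hθS0 hSW k) hms
  have hT : LocStencil₂ (0 : Fin (d + 1) → (Fin (d + 1) → ℤ) → Fin (d + 1) → (Fin (d + 1) → ℤ) → MKer (d + 1) (Fib d)) 0 m :=
    locStencil₂_zero_table
  have hθk : (0 : ℝ) ≤ 0 * θW ^ k := by positivity
  have hTT : LocStencil₂ ((0 : Fin (d + 1) → (Fin (d + 1) → ℤ) → Fin (d + 1) → (Fin (d + 1) → ℤ) → MKer (d + 1) (Fib d)) - 0) (0 * θW ^ k) m := by
    rw [sub_self, zero_mul]; exact locStencil₂_zero_table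
  have hMM : VertexFamily ((fun μ w => cΛ • hessFFAt (d := d) (toSite r) Lc μ w) - fun μ w => cΛ • hessFFAt (d := d) (toSite r) Lc μ w) Lc
      (0 * θW ^ k) m := by
    rw [sub_self]; exact vertexFamily_zero hθk
  have hMM₂ : LocStencilFM Lc (mixFF - mixFF) (0 * θW ^ k) m := by
    rw [sub_self]; exact locStencilFM_zero hθk
  rw [unitM_M1At_eq, unitM_M1At_eq, unitM₂_M2Of_eq hfm hm, unitM₂_M2Of_eq hfm hm]
  have h := vertexFamily₂_W2SymOfK_sub (N := Lc) hK1 hK0 hKK hm0 hS1 hS0 hSS hM hM hMM hT hT hTT hmixm hmixm hMM₂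
  rw [LW2_mul] at h
  exact h

/-- NOT IN PRINT; OUR BOOKKEEPING — A SOCKET (generic `d`, in-block root; [folklore] composition).  **ROW (F4a), `LocStencil₂` HALF, FOR THE DRESSED TOWER**:
the `T̃`-free source `b̃_j = (cE₂·Lc^{2(d+1)}) • mmRead Lc (K3OfK G̃_j Lc S̃′_j M̃_j (W2SymOfK G̃_j Lc S̃′_j M̃_j 0 M̃₂_j)) + cB • vh₂S` of
`T2RecOfUnitSplit.unitS₂_T2RecOf_eq_transport_add_sum` (comb data) is `j`-UNIFORMLY `LocStencil₂` — from the dressed K uniform row `hG`, «S′Shape» `hS`, the mixed-table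
letters and a `LocStencil₂` shape `hB` of the border (leaf-19's `locStencil₂_mmRead_K3OfK_family`, generic in the kernel family; `vertexFamily₂_zeroCarrier_of_rows`). -/
theorem source_shape_of_rows (hLc : 1 ≤ Lc) (hr : r ∈ box (d + 1) Lc) {C δ : ℝ}
    (hG : ∀ j, Decays (unitK (sfStep Lc j) (smStep d Lc j) (coDressKBmAt (toSite r) Lc (KInvStep (d := d) Lc j))) C δ) (hδ : 0 < δ)
    {Cs δs : ℝ} (hS : ∀ j, LocStencil (unitS (sfStep Lc j) (smStep d Lc j) (SpureRecAt d Lc (toSite r) cE cVH cΛ j)) Cs δs) (hδs : 0 < δs)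
    {CM₂ δ₄ : ℝ} (hmix : LocStencilFM Lc mixFF CM₂ δ₄) (hδ₄ : 0 < δ₄)
    (hfm : ∀ κ u ρ w x z (α μ' : Fin (d + 1)), mixFF κ u ρ w x z (Sum.inl α) (Sum.inr μ') = 0)
    (hm : ∀ κ u ρ w x z (μ' : Fin (d + 1)) (b : Fib d), mixFF κ u ρ w x z (Sum.inr μ') b = 0)
    {vh₂S : Fin (d + 1) → (Fin (d + 1) → ℤ) → Fin (d + 1) → (Fin (d + 1) → ℤ) → MKer (d + 1) (Fib d)} {CB δB : ℝ}
    (hB : LocStencil₂ vh₂S CB δB) (hδB : 0 < δB) (cE₂ cB : ℝ) :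
    ∃ Cb δb : ℝ, 0 < δb ∧ ∀ j, LocStencil₂ (fun κ u κ' u' =>
      (cE₂ * (Lc : ℝ) ^ (2 * (d + 1))) •
          mmRead Lc (K3OfK (unitK (sfStep Lc j) (smStep d Lc j) (coDressKBmAt (toSite r) Lc (KInvStep (d := d) Lc j))) Lc
            (unitS (sfStep Lc j) (smStep d Lc j) (SpureRecAt d Lc (toSite r) cE cVH cΛ j)) (unitM (sfStep Lc j) (smStep d Lc j) (M1At d Lc (toSite r) cΛ j))
            (W2SymOfK (unitK (sfStep Lc j) (smStep d Lc j) (coDressKBmAt (toSite r) Lc (KInvStep (d := d) Lc j))) Lc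
              (unitS (sfStep Lc j) (smStep d Lc j) (SpureRecAt d Lc (toSite r) cE cVH cΛ j)) (unitM (sfStep Lc j) (smStep d Lc j) (M1At d Lc (toSite r) cΛ j)) 0
              (unitM₂ (sfStep Lc j) (smStep d Lc j) (M2Of d Lc mixFF j))) κ u κ' u')
        + cB • vh₂S κ u κ' u') Cb δb := by
  obtain ⟨Cw, δW, hδW, hW0⟩ := vertexFamily₂_zeroCarrier_of_rows cE cVH cΛ hLc hr hG hδ hS hδs hmix hδ₄ hfm hm
  have hC : 0 ≤ C := (hG 0).nonneg (Sum.inl 0)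
  have hCs : 0 ≤ Cs := ((hS 0) 0 0).nonneg (Sum.inl 0)
  have hCw : 0 ≤ Cw := ((hW0 0) 0 0 0 0).nonneg (Sum.inl 0)
  set m : ℝ := min (min δ δs) (min δW δB) with hm_def
  have hm0 : 0 < m := lt_min (lt_min hδ hδs) (lt_min hδW hδB)
  have hmW : m ≤ δW := (min_le_right _ _).trans (min_le_left _ _)
  have hmB : m ≤ δB := (min_le_right _ _).trans (min_le_right _ _)
  have hms : m ≤ δs := (min_le_left _ _).trans (min_le_right _ _)
  have hmK : m ≤ δ := (min_le_left _ _).trans (min_le_left _ _)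
  set CM : ℝ := |cΛ| * (2 * (ell (d + 1) Lc : ℝ) ^ 2 * Real.exp (4 * ((d : ℝ) + 1) * Lc * m)) with hCM_def
  have hK' : ∀ j, Decays (unitK (sfStep Lc j) (smStep d Lc j) (coDressKBmAt (toSite r) Lc (KInvStep (d := d) Lc j))) C m :=
    fun j => decays_mono (hG j) hC le_rfl hmK
  have hS' : ∀ j, LocStencil (unitS (sfStep Lc j) (smStep d Lc j) (SpureRecAt d Lc (toSite r) cE cVH cΛ j)) Cs m :=
    fun j => locStencil_mono' (hS j) le_rfl hms
  have hM' : ∀ j, VertexFamily (unitM (sfStep Lc j) (smStep d Lc j) (M1At d Lc (toSite r) cΛ j)) Lc CM m := by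
    intro j
    rw [unitM_M1At_eq]
    exact vertexFamily_smul_hessFFAt hLc hr cΛ hm0.le
  have hW' : ∀ j, VertexFamily₂ (W2SymOfK (unitK (sfStep Lc j) (smStep d Lc j) (coDressKBmAt (toSite r) Lc (KInvStep (d := d) Lc j))) Lc
      (unitS (sfStep Lc j) (smStep d Lc j) (SpureRecAt d Lc (toSite r) cE cVH cΛ j)) (unitM (sfStep Lc j) (smStep d Lc j) (M1At d Lc (toSite r) cΛ j)) 0
      (unitM₂ (sfStep Lc j) (smStep d Lc j) (M2Of d Lc mixFF j))) Lc Cw m :=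
    fun j => vertexFamily₂_mono (hW0 j) hCw hmW
  obtain ⟨C', hC', hval⟩ := locStencil₂_mmRead_K3OfK_family (Lc := Lc) hLc hC hm0 hK' hS' hM' hW'
    (fun j μ y ν y' => W2SymOfK_swap _ _ _ _ _ _ μ y ν y')
  have hm128 : m / 128 ≤ δB := by linarith [hmB, hm0]
  refine ⟨|cE₂ * (Lc : ℝ) ^ (2 * (d + 1))| * C' + |cB| * CB, m / 128, by positivity, fun j => ?_⟩
  exact locStencil₂_add' (locStencil₂_smul' _ (hval j)) (locStencil₂_smul' cB (hB.mono hm128))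

/-- NOT IN PRINT; OUR BOOKKEEPING — A SOCKET (generic `d`, in-block root; [folklore] composition).  **ROW (F4b), SOURCE-DIFFERENCE SOCKET, FOR THE DRESSED
TOWER**: the source `b̃` is CAUCHY AT A GEOMETRIC RATE — `∃ cb θb δb, 0 ≤ cb ∧ 0 ≤ θb ∧ θb < 1 ∧ 0 < δb ∧ ∀ k j, LocStencil₂ (b̃_{k+j} − b̃_k) (cb·θb^k) δb` — from the
dressed K rows (`hG`, `hGall`), «S′Shape» ∧ «S′Drift» and the mixed-table letters: the `j`-free border CANCELS; leaf-08's `mmRead_K3OfK_cauchy` ONCE per pair at the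
common rate and ratio `θb = max θK θS` (the zero-`T₂` carrier's rows by §1). -/
theorem source_cauchy_of_rows (hLc : 1 ≤ Lc) (hr : r ∈ box (d + 1) Lc) {C δ cK θK : ℝ}
    (hG : ∀ j, Decays (unitK (sfStep Lc j) (smStep d Lc j) (coDressKBmAt (toSite r) Lc (KInvStep (d := d) Lc j))) C δ)
    (hGall : ∀ k j, Decays (unitK (sfStep Lc (k + j)) (smStep d Lc (k + j)) (coDressKBmAt (toSite r) Lc (KInvStep (d := d) Lc (k + j))) -
      unitK (sfStep Lc k) (smStep d Lc k) (coDressKBmAt (toSite r) Lc (KInvStep (d := d) Lc k))) (cK * θK ^ k) δ)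
    (hδ : 0 < δ) (hθK0 : 0 ≤ θK) (hθK1 : θK < 1)
    {Cs cS θS δs : ℝ} (hS : ∀ j, LocStencil (unitS (sfStep Lc j) (smStep d Lc j) (SpureRecAt d Lc (toSite r) cE cVH cΛ j)) Cs δs)
    (hSall : ∀ k j, LocStencil (unitS (sfStep Lc (k + j)) (smStep d Lc (k + j)) (SpureRecAt d Lc (toSite r) cE cVH cΛ (k + j)) -
      unitS (sfStep Lc k) (smStep d Lc k) (SpureRecAt d Lc (toSite r) cE cVH cΛ k)) (cS * θS ^ k) δs)
    (hδs : 0 < δs) (hθS0 : 0 ≤ θS) (hθS1 : θS < 1)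
    {CM₂ δ₄ : ℝ} (hmix : LocStencilFM Lc mixFF CM₂ δ₄) (hδ₄ : 0 < δ₄)
    (hfm : ∀ κ u ρ w x z (α μ' : Fin (d + 1)), mixFF κ u ρ w x z (Sum.inl α) (Sum.inr μ') = 0)
    (hm : ∀ κ u ρ w x z (μ' : Fin (d + 1)) (b : Fib d), mixFF κ u ρ w x z (Sum.inr μ') b = 0)
    (vh₂S : Fin (d + 1) → (Fin (d + 1) → ℤ) → Fin (d + 1) → (Fin (d + 1) → ℤ) → MKer (d + 1) (Fib d)) (cE₂ cB : ℝ) :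
    ∃ cb θb δb : ℝ, 0 ≤ cb ∧ 0 ≤ θb ∧ θb < 1 ∧ 0 < δb ∧ ∀ k j, LocStencil₂ (fun κ u κ' u' =>
      ((cE₂ * (Lc : ℝ) ^ (2 * (d + 1))) •
          mmRead Lc (K3OfK (unitK (sfStep Lc (k + j)) (smStep d Lc (k + j)) (coDressKBmAt (toSite r) Lc (KInvStep (d := d) Lc (k + j)))) Lc
            (unitS (sfStep Lc (k + j)) (smStep d Lc (k + j)) (SpureRecAt d Lc (toSite r) cE cVH cΛ (k + j)))
            (unitM (sfStep Lc (k + j)) (smStep d Lc (k + j)) (M1At d Lc (toSite r) cΛ (k + j)))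
            (W2SymOfK (unitK (sfStep Lc (k + j)) (smStep d Lc (k + j)) (coDressKBmAt (toSite r) Lc (KInvStep (d := d) Lc (k + j)))) Lc
              (unitS (sfStep Lc (k + j)) (smStep d Lc (k + j)) (SpureRecAt d Lc (toSite r) cE cVH cΛ (k + j)))
              (unitM (sfStep Lc (k + j)) (smStep d Lc (k + j)) (M1At d Lc (toSite r) cΛ (k + j))) 0
              (unitM₂ (sfStep Lc (k + j)) (smStep d Lc (k + j)) (M2Of d Lc mixFF (k + j)))) κ u κ' u')
        + cB • vh₂S κ u κ' u')
      - ((cE₂ * (Lc : ℝ) ^ (2 * (d + 1))) •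
          mmRead Lc (K3OfK (unitK (sfStep Lc k) (smStep d Lc k) (coDressKBmAt (toSite r) Lc (KInvStep (d := d) Lc k))) Lc
            (unitS (sfStep Lc k) (smStep d Lc k) (SpureRecAt d Lc (toSite r) cE cVH cΛ k)) (unitM (sfStep Lc k) (smStep d Lc k) (M1At d Lc (toSite r) cΛ k))
            (W2SymOfK (unitK (sfStep Lc k) (smStep d Lc k) (coDressKBmAt (toSite r) Lc (KInvStep (d := d) Lc k))) Lc
              (unitS (sfStep Lc k) (smStep d Lc k) (SpureRecAt d Lc (toSite r) cE cVH cΛ k)) (unitM (sfStep Lc k) (smStep d Lc k) (M1At d Lc (toSite r) cΛ k)) 0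
              (unitM₂ (sfStep Lc k) (smStep d Lc k) (M2Of d Lc mixFF k))) κ u κ' u')
        + cB • vh₂S κ u κ' u')) (cb * θb ^ k) δb := by
  -- the zero-`T₂` carrier's uniform and Cauchy rows
  obtain ⟨Cw, δW, hδW, hW0⟩ := vertexFamily₂_zeroCarrier_of_rows cE cVH cΛ hLc hr hG hδ hS hδs hmix hδ₄ hfm hm
  obtain ⟨cW, θW, δW', hθW0, hθW1, hδW', hW0c⟩ :=
    vertexFamily₂_zeroCarrier_cauchy_of_rows cE cVH cΛ hLc hr hG hGall hδ hθK0 hθK1 hS hSall hδs hθS0 hθS1 hmix hδ₄ hfm hm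
  -- nonnegativity of the data constants
  have hC : 0 ≤ C := (hG 0).nonneg (Sum.inl 0)
  have hcK : 0 ≤ cK := by have h := (hGall 0 0).nonneg (Sum.inl 0); simpa using h
  have hCs : 0 ≤ Cs := ((hS 0) 0 0).nonneg (Sum.inl 0)
  have hcS : 0 ≤ cS := by have h := ((hSall 0 0) 0 0).nonneg (Sum.inl 0); simpa using h
  have hCw : 0 ≤ Cw := ((hW0 0) 0 0 0 0).nonneg (Sum.inl 0)
  have hcW : 0 ≤ cW := by have h := ((hW0c 0 0) 0 0 0 0).nonneg (Sum.inl 0); simpa using h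
  -- the common ratio and the common rate
  set θb : ℝ := max θK (max θS θW) with hθb_def
  have hθb0 : 0 ≤ θb := hθK0.trans (le_max_left _ _)
  have hθb1 : θb < 1 := max_lt hθK1 (max_lt hθS1 hθW1)
  have hKb : θK ≤ θb := le_max_left _ _
  have hSb : θS ≤ θb := (le_max_left _ _).trans (le_max_right _ _)
  have hWb : θW ≤ θb := (le_max_right _ _).trans (le_max_right _ _)
  set m : ℝ := min δ (min δs (min δW δW')) with hm_def
  have hm0 : 0 < m := lt_min hδ (lt_min hδs (lt_min hδW hδW'))
  have hmδ : m ≤ δ := min_le_left _ _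
  have hms : m ≤ δs := (min_le_right _ _).trans (min_le_left _ _)
  have hmW : m ≤ δW := (min_le_right _ _).trans ((min_le_right _ _).trans (min_le_left _ _))
  have hmW' : m ≤ δW' := (min_le_right _ _).trans ((min_le_right _ _).trans (min_le_right _ _))
  -- the data families at the common rate and ratio
  set CM : ℝ := |cΛ| * (2 * (ell (d + 1) Lc : ℝ) ^ 2 * Real.exp (4 * ((d : ℝ) + 1) * Lc * m)) with hCM_def
  have hK1 : ∀ j, Decays (unitK (sfStep Lc j) (smStep d Lc j) (coDressKBmAt (toSite r) Lc (KInvStep (d := d) Lc j))) C m :=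
    fun j => decays_mono (hG j) hC le_rfl hmδ
  have hKc : ∀ k j, Decays (unitK (sfStep Lc (k + j)) (smStep d Lc (k + j)) (coDressKBmAt (toSite r) Lc (KInvStep (d := d) Lc (k + j))) -
      unitK (sfStep Lc k) (smStep d Lc k) (coDressKBmAt (toSite r) Lc (KInvStep (d := d) Lc k))) (cK * θb ^ k) m :=
    fun k j => decays_mono (hGall k j) (by positivity) (mul_pow_le_mul_pow hcK hθK0 hKb k) hmδ
  have hS1 : ∀ j, LocStencil (unitS (sfStep Lc j) (smStep d Lc j) (SpureRecAt d Lc (toSite r) cE cVH cΛ j)) Cs m :=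
    fun j => locStencil_mono' (hS j) le_rfl hms
  have hSc : ∀ k j, LocStencil (unitS (sfStep Lc (k + j)) (smStep d Lc (k + j)) (SpureRecAt d Lc (toSite r) cE cVH cΛ (k + j)) -
      unitS (sfStep Lc k) (smStep d Lc k) (SpureRecAt d Lc (toSite r) cE cVH cΛ k)) (cS * θb ^ k) m :=
    fun k j => locStencil_mono' (hSall k j) (mul_pow_le_mul_pow hcS hθS0 hSb k) hms
  have hM1 : ∀ j, VertexFamily (unitM (sfStep Lc j) (smStep d Lc j) (M1At d Lc (toSite r) cΛ j)) Lc CM m := by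
    intro j
    rw [unitM_M1At_eq]
    exact vertexFamily_smul_hessFFAt hLc hr cΛ hm0.le
  have hMc : ∀ k j, VertexFamily (unitM (sfStep Lc (k + j)) (smStep d Lc (k + j)) (M1At d Lc (toSite r) cΛ (k + j)) -
      unitM (sfStep Lc k) (smStep d Lc k) (M1At d Lc (toSite r) cΛ k)) Lc (0 * θb ^ k) m := by
    intro k j
    rw [unitM_M1At_eq, unitM_M1At_eq, sub_self]
    exact vertexFamily_zero (by positivity)
  have hW1 : ∀ j, VertexFamily₂ (W2SymOfK (unitK (sfStep Lc j) (smStep d Lc j) (coDressKBmAt (toSite r) Lc (KInvStep (d := d) Lc j))) Lc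
      (unitS (sfStep Lc j) (smStep d Lc j) (SpureRecAt d Lc (toSite r) cE cVH cΛ j)) (unitM (sfStep Lc j) (smStep d Lc j) (M1At d Lc (toSite r) cΛ j)) 0
      (unitM₂ (sfStep Lc j) (smStep d Lc j) (M2Of d Lc mixFF j))) Lc Cw m :=
    fun j => vertexFamily₂_mono (hW0 j) hCw hmW
  have hWc : ∀ k j, VertexFamily₂
      (W2SymOfK (unitK (sfStep Lc (k + j)) (smStep d Lc (k + j)) (coDressKBmAt (toSite r) Lc (KInvStep (d := d) Lc (k + j)))) Lc
          (unitS (sfStep Lc (k + j)) (smStep d Lc (k + j)) (SpureRecAt d Lc (toSite r) cE cVH cΛ (k + j)))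
          (unitM (sfStep Lc (k + j)) (smStep d Lc (k + j)) (M1At d Lc (toSite r) cΛ (k + j))) 0
          (unitM₂ (sfStep Lc (k + j)) (smStep d Lc (k + j)) (M2Of d Lc mixFF (k + j))) -
        W2SymOfK (unitK (sfStep Lc k) (smStep d Lc k) (coDressKBmAt (toSite r) Lc (KInvStep (d := d) Lc k))) Lc
          (unitS (sfStep Lc k) (smStep d Lc k) (SpureRecAt d Lc (toSite r) cE cVH cΛ k)) (unitM (sfStep Lc k) (smStep d Lc k) (M1At d Lc (toSite r) cΛ k)) 0
          (unitM₂ (sfStep Lc k) (smStep d Lc k) (M2Of d Lc mixFF k))) Lc (cW * θb ^ k) m :=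
    fun k j μ y ν y' => biLoc_le_mono (hW0c k j μ y ν y') (by positivity) (mul_pow_le_mul_pow hcW hθW0 hWb k) hmW'
  have hWs : ∀ (j : ℕ) (μ : Fin (d + 1)) (y : Fin (d + 1) → ℤ) (ν : Fin (d + 1)) (y' : Fin (d + 1) → ℤ),
      W2SymOfK (unitK (sfStep Lc j) (smStep d Lc j) (coDressKBmAt (toSite r) Lc (KInvStep (d := d) Lc j))) Lc
          (unitS (sfStep Lc j) (smStep d Lc j) (SpureRecAt d Lc (toSite r) cE cVH cΛ j)) (unitM (sfStep Lc j) (smStep d Lc j) (M1At d Lc (toSite r) cΛ j)) 0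
          (unitM₂ (sfStep Lc j) (smStep d Lc j) (M2Of d Lc mixFF j)) ν y' μ y =
        W2SymOfK (unitK (sfStep Lc j) (smStep d Lc j) (coDressKBmAt (toSite r) Lc (KInvStep (d := d) Lc j))) Lc
          (unitS (sfStep Lc j) (smStep d Lc j) (SpureRecAt d Lc (toSite r) cE cVH cΛ j)) (unitM (sfStep Lc j) (smStep d Lc j) (M1At d Lc (toSite r) cΛ j)) 0
          (unitM₂ (sfStep Lc j) (smStep d Lc j) (M2Of d Lc mixFF j)) μ y ν y' :=
    fun j μ y ν y' => W2SymOfK_swap _ _ _ _ _ _ μ y ν y'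
  have hCM : 0 ≤ CM := ((hM1 0) 0 0).nonneg (Sum.inl 0)
  have hL : 0 ≤ lK3 d C Cs CM Cw cK cS 0 cW (m / 4) := lK3_nonneg hC hCs hCM hCw hcK hcS le_rfl hcW (by positivity)
  refine ⟨|cE₂ * (Lc : ℝ) ^ (2 * (d + 1))| * lK3 d C Cs CM Cw cK cS 0 cW (m / 4), θb, m / 128, by positivity, hθb0, hθb1,
    by positivity, fun k j => ?_⟩
  have key := locStencil₂_smul' (cE₂ * (Lc : ℝ) ^ (2 * (d + 1)))
    (mmRead_K3OfK_cauchy hLc hm0 hK1 hKc hS1 hSc hM1 hMc hW1 hWc hWs k j)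
  intro κ u κ' u'
  dsimp only
  rw [smul_add_sub_smul_add, show |cE₂ * (Lc : ℝ) ^ (2 * (d + 1))| * lK3 d C Cs CM Cw cK cS 0 cW (m / 4) * θb ^ k
      = |cE₂ * (Lc : ℝ) ^ (2 * (d + 1))| * (lK3 d C Cs CM Cw cK cS 0 cW (m / 4) * θb ^ k) by ring]
  exact key κ u κ' u'

end Generic

/-! ## §2 `d = 3`, `Lc ≥ 2`: both source rows from the comb family's S-slot rows and the border shape alone -/

section Three

variable {Lc : ℕ} [NeZero Lc] {r : Fin (3 + 1) → ℕ}

/-- NOT IN PRINT; OUR BOOKKEEPING — A SOCKET (`d = 3`, `2 ≤ Lc`, in-block root `r`, an1's rooted mixed table `mixFFAt (toSite r) Lc`; every `cE cVH cΛ cE₂ cB`, every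
second-order border `vh₂S` with a `LocStencil₂` shape).  **ROWS (F4a)-`LocStencil₂` AND (F4b)-socket OF THE DRESSED TOWER FROM THE COMB FAMILY's (hS, hSall) ALONE**:
dressed K rows by asym1's `exists_coDressedBm_unit_rows` ∘ road P1's `convCKWall_holds`, «S′Shape» ∧ «S′Drift» by `WrecAtSlotRows.exists_spureRecAt_rows_three_of_srecAt_rows`,
the mixed table by an1's `hmix_an1` ∕ `mixFFAt_inl_inr` ∕ `mixFFAt_inr`.  Discharges NOTHING of «T2Shape» ∕ «T2Drift»: the `mom` ∕ `Zfree` halves and the transport rows are OPEN. -/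
theorem source_rows_three_of_srecAt_rows (hLc : 2 ≤ Lc) (hr : r ∈ box (3 + 1) Lc) (cE cVH cΛ cE₂ cB : ℝ)
    {vh₂S : Fin (3 + 1) → (Fin (3 + 1) → ℤ) → Fin (3 + 1) → (Fin (3 + 1) → ℤ) → MKer (3 + 1) (Fib 3)} {CB δB : ℝ}
    (hB : LocStencil₂ vh₂S CB δB) (hδB : 0 < δB)
    {Cs cS θS δS : ℝ} (hS : ∀ j, LocStencil (unitS (sfStep Lc j) (smStep 3 Lc j) (SrecAt 3 Lc (toSite r) cE cVH cΛ j)) Cs δS)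
    (hSall : ∀ k j, LocStencil (unitS (sfStep Lc (k + j)) (smStep 3 Lc (k + j)) (SrecAt 3 Lc (toSite r) cE cVH cΛ (k + j)) -
      unitS (sfStep Lc k) (smStep 3 Lc k) (SrecAt 3 Lc (toSite r) cE cVH cΛ k)) (cS * θS ^ k) δS)
    (hδS : 0 < δS) (hθS0 : 0 ≤ θS) (hθS1 : θS < 1) :
    (∃ Cb δb : ℝ, 0 < δb ∧ ∀ j, LocStencil₂ (fun κ u κ' u' =>
      (cE₂ * (Lc : ℝ) ^ (2 * (3 + 1))) •
          mmRead Lc (K3OfK (unitK (sfStep Lc j) (smStep 3 Lc j) (coDressKBmAt (toSite r) Lc (KInvStep (d := 3) Lc j))) Lc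
            (unitS (sfStep Lc j) (smStep 3 Lc j) (SpureRecAt 3 Lc (toSite r) cE cVH cΛ j)) (unitM (sfStep Lc j) (smStep 3 Lc j) (M1At 3 Lc (toSite r) cΛ j))
            (W2SymOfK (unitK (sfStep Lc j) (smStep 3 Lc j) (coDressKBmAt (toSite r) Lc (KInvStep (d := 3) Lc j))) Lc
              (unitS (sfStep Lc j) (smStep 3 Lc j) (SpureRecAt 3 Lc (toSite r) cE cVH cΛ j)) (unitM (sfStep Lc j) (smStep 3 Lc j) (M1At 3 Lc (toSite r) cΛ j)) 0
              (unitM₂ (sfStep Lc j) (smStep 3 Lc j) (M2Of 3 Lc (mixFFAt (toSite r) Lc) j))) κ u κ' u')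
        + cB • vh₂S κ u κ' u') Cb δb) ∧
    (∃ cb θb δb : ℝ, 0 ≤ cb ∧ 0 ≤ θb ∧ θb < 1 ∧ 0 < δb ∧ ∀ k j, LocStencil₂ (fun κ u κ' u' =>
      ((cE₂ * (Lc : ℝ) ^ (2 * (3 + 1))) •
          mmRead Lc (K3OfK (unitK (sfStep Lc (k + j)) (smStep 3 Lc (k + j)) (coDressKBmAt (toSite r) Lc (KInvStep (d := 3) Lc (k + j)))) Lc
            (unitS (sfStep Lc (k + j)) (smStep 3 Lc (k + j)) (SpureRecAt 3 Lc (toSite r) cE cVH cΛ (k + j)))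
            (unitM (sfStep Lc (k + j)) (smStep 3 Lc (k + j)) (M1At 3 Lc (toSite r) cΛ (k + j)))
            (W2SymOfK (unitK (sfStep Lc (k + j)) (smStep 3 Lc (k + j)) (coDressKBmAt (toSite r) Lc (KInvStep (d := 3) Lc (k + j)))) Lc
              (unitS (sfStep Lc (k + j)) (smStep 3 Lc (k + j)) (SpureRecAt 3 Lc (toSite r) cE cVH cΛ (k + j)))
              (unitM (sfStep Lc (k + j)) (smStep 3 Lc (k + j)) (M1At 3 Lc (toSite r) cΛ (k + j))) 0
              (unitM₂ (sfStep Lc (k + j)) (smStep 3 Lc (k + j)) (M2Of 3 Lc (mixFFAt (toSite r) Lc) (k + j)))) κ u κ' u')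
        + cB • vh₂S κ u κ' u')
      - ((cE₂ * (Lc : ℝ) ^ (2 * (3 + 1))) •
          mmRead Lc (K3OfK (unitK (sfStep Lc k) (smStep 3 Lc k) (coDressKBmAt (toSite r) Lc (KInvStep (d := 3) Lc k))) Lc
            (unitS (sfStep Lc k) (smStep 3 Lc k) (SpureRecAt 3 Lc (toSite r) cE cVH cΛ k)) (unitM (sfStep Lc k) (smStep 3 Lc k) (M1At 3 Lc (toSite r) cΛ k))
            (W2SymOfK (unitK (sfStep Lc k) (smStep 3 Lc k) (coDressKBmAt (toSite r) Lc (KInvStep (d := 3) Lc k))) Lc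
              (unitS (sfStep Lc k) (smStep 3 Lc k) (SpureRecAt 3 Lc (toSite r) cE cVH cΛ k)) (unitM (sfStep Lc k) (smStep 3 Lc k) (M1At 3 Lc (toSite r) cΛ k)) 0
              (unitM₂ (sfStep Lc k) (smStep 3 Lc k) (M2Of 3 Lc (mixFFAt (toSite r) Lc) k))) κ u κ' u')
        + cB • vh₂S κ u κ' u')) (cb * θb ^ k) δb) := by
  have hLc1 : 1 ≤ Lc := by omega
  obtain ⟨C, δK, cK, θK, hδK, hθK0, hθK1, hK, hKall⟩ := convCKWall_holds (Lc := Lc) hLc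
  obtain ⟨c, -, hG, hGall⟩ := exists_coDressedBm_unit_rows hLc1 hr (sfStep Lc) (smStep 3 Lc) sfStep_ne_zero smStep_ne_zero
    (K := fun j => KInvStep (d := 3) Lc j) hδK hK hKall
  obtain ⟨CM₂, δ₄, hδ₄, hmix⟩ := hmix_an1 (d := 3) (Lc := Lc) hLc1 hr
  obtain ⟨Cs', cS', θ', δ', hθ'0, hθ'1, hδ', hS', hSall'⟩ :=
    exists_spureRecAt_rows_three_of_srecAt_rows hLc hr cE cVH cΛ hS hSall hδS hθS0 hθS1
  have hδG : 0 < δK / 4 := by positivity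
  exact ⟨source_shape_of_rows cE cVH cΛ hLc1 hr hG hδG hS' hδ' hmix hδ₄
      (fun κ u ρ' w x z α μ' => mixFFAt_inl_inr (toSite r) Lc κ u ρ' w x z α μ') (fun κ u ρ' w x z μ' b => mixFFAt_inr (toSite r) Lc κ u ρ' w x z μ' b)
      hB hδB cE₂ cB,
    source_cauchy_of_rows cE cVH cΛ hLc1 hr hG hGall hδG hθK0 hθK1 hS' hSall' hδ' hθ'0 hθ'1 hmix hδ₄
      (fun κ u ρ' w x z α μ' => mixFFAt_inl_inr (toSite r) Lc κ u ρ' w x z α μ') (fun κ u ρ' w x z μ' b => mixFFAt_inr (toSite r) Lc κ u ρ' w x z μ' b)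
      vh₂S cE₂ cB⟩

end Three
end Summit.QuantumFields.BalabanUV.Beta.GAN24.T2RecSourceRows

end
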